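import Summits.BirchSwinnertonDyer.BirchSwinnertonDyer.Theorems.GoldfeldAllTwistsTwoConverseTwinInertSevenSplitSymbol
import HarnessLib

set_option linter.dupNamespace false -- namespace `…BirchSwinnertonDyer.BirchSwinnertonDyer…` is the cell's (D-0017 nested layout)
set_option autoImplicit false

/-!
# Twin″ (item 19140), 7-INERT half: the SPLIT SYMBOL at `ℓ`, part 2 — the dichotomy on the cell's curves
# `49a1^{(ℓ)}`, `49a1^{(−ℓ)}` and the auxiliary partner `49a1^{(a₀ℓ)}`

Cell `bsd-goldfeld`, seat `bsd-goldfeld-s1p-c301` (prover, gen 13); `--supports stmt-BirchSwinnertonDyer-19140`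
(twin″) as a HELPER; sequel of `…TwinInertSevenSplitSymbol` (the identity `(t + s(3t+8))² = 2(21+8t)(s−21)` and the
general `ℓ`-class exclusion theorems `ell_mul_not_mem_twoIsogenySelmerGroup[']_of_not_isSquare`). Here they are
specialised to the three curves of the auxiliary-prime road on the prime family `𝒮` of the 7-inert half
(model `E_M : y² = x³ + 21M x² + 112M² x ≅ 49a1^{(M)}`, `S(M) = twoIsogenySelmerGroup (21M) (112M²)`,
`S'(M) = twoIsogenySelmerGroup (−42M) (−7M²)`; `σ(ℓ) = +1` iff `2(s − 21) ∈ 𝔽_ℓ²`, `s² = −7`):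
* `σ(ℓ) = −1`: `ℓ, 7ℓ ∉ S(ℓ)`, `ℓ, −7ℓ ∉ S'(ℓ)` (`ell_classes_not_mem_selmer_posTwist_of_symbol_neg`) and
  `ℓ, 7ℓ ∉ S(−ℓ)` (`ell_classes_not_mem_selmer_negTwist_of_symbol_neg`);
* `σ(ℓ) = +1`: `2ℓ, 14ℓ ∉ S(−ℓ)` when `2 ∉ 𝔽_ℓ²`, i.e. `ℓ ≡ ±3 (mod 8)`
  (`two_ell_classes_not_mem_selmer_negTwist_of_symbol_pos`), and `ℓ, 7ℓ ∉ S(a₀ℓ)`, `ℓ, −7ℓ ∉ S'(a₀ℓ)` for every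
  `a₀` with `ℓ ∤ a₀`, `a₀ ∉ 𝔽_ℓ²` (`ell_classes_not_mem_selmer_auxTwist_of_symbol_pos`) — the flip by `(a₀/ℓ) = −1`.
With part VIII (`card_twoIsogenySelmerGroup_splitPrimeTwist_le`: `S(−ℓ) ⊆ {1,7,ℓ,2ℓ,7ℓ,14ℓ}` for `ℓ ≡ 5 (mod 8)`)
this pins the SHAPE of `S(−ℓ)` by `σ(ℓ)`: `⊆ {1,7,2ℓ,14ℓ}` if `σ = −1`, `⊆ {1,7,ℓ,7ℓ}` if `σ = +1` — the law
observed on all `ℓ < 6000` by kit job j287842 (memo `HOME/INERT7-AUXPRIME-HORIZON.md`), together with the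
COMPLEMENTARITY «exactly one of `Sel₂(49a1^{(ℓ)})`, `Sel₂(49a1^{(a₀ℓ)})` is minimal» whose `ℓ`-adic half is the
pair (`…posTwist_of_symbol_neg`, `…auxTwist_of_symbol_pos`). The classes prime to `ℓ` are not treated here.

HONEST FRAMING: `ℓ`-adic local algebra only; no Selmer set is computed in full, no rank bounded, no case of twin″
or K12₂″ decided; BSD is not proved by any of this.

References: Silverman, *AEC* (2009), X.4.9 [SilvermanAEC2009].
-/

noncomputable section

open scoped Classical

open WeierstrassCurve Literature.NumberTheory.EllipticCurves

namespace Summit.BirchSwinnertonDyer.BirchSwinnertonDyer.Theorems.GoldfeldGoodTwists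

/-! ## §5. The dichotomy on the cell's curves: `49a1^{(ℓ)}`, `49a1^{(−ℓ)}`, `49a1^{(aℓ)}` -/

section Families

variable {l : ℕ} [Fact l.Prime]

/-- For `ℓ ≡ 1 (mod 4)` prime with `(−7/ℓ) = 1`: square roots `s` of `−7` and `t` of `7` exist in `𝔽_ℓ`
(`(7/ℓ) = (−1/ℓ)(−7/ℓ) = 1`). [folklore] -/
theorem exists_sq_eq_neg_seven_and_sq_eq_seven (hl4 : l % 4 = 1) (hl7 : legendreSym l (-7) = 1) :
    ∃ s t : ZMod l, s ^ 2 = -7 ∧ t ^ 2 = 7 := by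
  have hl : l.Prime := Fact.out
  have hl2 : l ≠ 2 := by rintro rfl; norm_num at hl4
  have hl7' : l ≠ 7 := by rintro rfl; norm_num at hl4
  have h70 : ((7 : ℤ) : ZMod l) ≠ 0 := by exact_mod_cast zmod_seven_ne_zero_of_prime_ne_seven hl7'
  have hm70 : ((-7 : ℤ) : ZMod l) ≠ 0 := by
    push_cast; exact neg_ne_zero.mpr (zmod_seven_ne_zero_of_prime_ne_seven hl7')
  have h1 : legendreSym l (-1) = 1 := by
    rw [legendreSym.at_neg_one hl2, ZMod.χ₄_nat_one_mod_four hl4]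
  have h7 : legendreSym l 7 = 1 := by
    have hmul : legendreSym l (-7) = legendreSym l (-1) * legendreSym l 7 := by
      rw [← legendreSym.mul]; norm_num
    rwa [hmul, h1, one_mul] at hl7
  obtain ⟨s, hs⟩ := (legendreSym.eq_one_iff l hm70).mp hl7
  obtain ⟨t, ht⟩ := (legendreSym.eq_one_iff l h70).mp h7
  have hs' : s * s = -7 := by exact_mod_cast hs.symm
  have ht' : t * t = 7 := by exact_mod_cast ht.symm
  exact ⟨s, t, by rw [pow_two, hs'], by rw [pow_two, ht']⟩

variable {s t : ZMod l}

/-- `16 = 4²` and `112 = 7·4²` are squares mod `ℓ` when `7` is. [folklore] -/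
theorem isSquare_sixteen_and_onehundredtwelve_zmod (hsq7 : IsSquare (7 : ZMod l)) :
    IsSquare (16 : ZMod l) ∧ IsSquare (112 : ZMod l) := by
  obtain ⟨r, hr⟩ := hsq7
  exact ⟨⟨4, by norm_num⟩, ⟨4 * r, by linear_combination 16 * hr⟩⟩

/-- **`σ(ℓ) = −1`, positive partner `49a1^{(ℓ)}`**: for a prime `ℓ ∉ {2,7}` with `s² = −7`, `t² = 7` in
`𝔽_ℓ` and `2(s − 21) ∉ 𝔽_ℓ²`, the `ℓ`-classes `ℓ, 7ℓ` are not in `S(ℓ) = twoIsogenySelmerGroup (21ℓ) (112ℓ²)`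
and `ℓ, −7ℓ` are not in `S'(ℓ) = twoIsogenySelmerGroup (−42ℓ) (−7ℓ²)` (the Selmer sets of
`y² = x³ + 21ℓx² + 112ℓ²x ≅ 49a1^{(ℓ)}`). [cite: SilvermanAEC2009, Prop. X.4.9 and Example X.4.10] -/
theorem ell_classes_not_mem_selmer_posTwist_of_symbol_neg (hl2 : l ≠ 2) (hl7 : l ≠ 7)
    (hs : s ^ 2 = -7) (ht : t ^ 2 = 7) (hσ : ¬ IsSquare (2 * (s - 21))) :
    (l : ℤ) ∉ twoIsogenySelmerGroup (21 * (l : ℤ)) (112 * (l : ℤ) ^ 2) ∧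
      7 * (l : ℤ) ∉ twoIsogenySelmerGroup (21 * (l : ℤ)) (112 * (l : ℤ) ^ 2) ∧
      (l : ℤ) ∉ twoIsogenySelmerGroup (-42 * (l : ℤ)) (-7 * (l : ℤ) ^ 2) ∧
      -7 * (l : ℤ) ∉ twoIsogenySelmerGroup (-42 * (l : ℤ)) (-7 * (l : ℤ) ^ 2) := by
  have h7F : (7 : ZMod l) ≠ 0 := zmod_seven_ne_zero_of_prime_ne_seven hl7
  have hsq7 : IsSquare (7 : ZMod l) := ⟨t, by rw [← pow_two, ht]⟩
  obtain ⟨hsq16, hsq112⟩ := isSquare_sixteen_and_onehundredtwelve_zmod hsq7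
  have hsqm7 : IsSquare (-7 : ZMod l) := ⟨s, by rw [← pow_two, hs]⟩
  have h16 : (16 : ZMod l) ≠ 0 := by
    have := zmod_two_ne_zero_of_prime_ne_two hl2; have h : (16 : ZMod l) = 2 ^ 4 := by norm_num
    rw [h]; exact pow_ne_zero _ this
  have h112 : (112 : ZMod l) ≠ 0 := by
    have h : (112 : ZMod l) = 16 * 7 := by norm_num
    rw [h]; exact mul_ne_zero h16 h7F
  have hm : ¬ (l : ℤ) ∣ 1 := fun h =>
    (Fact.out : l.Prime).ne_one (Nat.dvd_one.mp (by exact_mod_cast h))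
  refine ⟨?_, ?_, ?_, ?_⟩
  · have := ell_mul_not_mem_twoIsogenySelmerGroup_of_not_isSquare hl2 hl7 hs hsq7 (m₀ := 1) (d₀ := 1)
      (e₀ := 112) hm (by norm_num) (by
        push_cast; simpa [mul_assoc] using not_isSquare_mul_of_isSquare_right h112 hsq112 hσ)
    simpa only [mul_one] using this
  · have := ell_mul_not_mem_twoIsogenySelmerGroup_of_not_isSquare hl2 hl7 hs hsq7 (m₀ := 1) (d₀ := 7)
      (e₀ := 16) hm (by norm_num) (by
        push_cast; simpa [mul_assoc] using not_isSquare_mul_of_isSquare_right h16 hsq16 hσ)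
    simpa only [mul_one, mul_comm (l : ℤ) 7] using this
  · have := ell_mul_not_mem_twoIsogenySelmerGroup'_of_not_isSquare hl2 hl7 hs ht (m₀ := 1) (d₀ := 1)
      (e₀ := -7) hm (by norm_num) (by
        push_cast
        simpa [mul_assoc] using not_isSquare_mul_of_isSquare_right (neg_ne_zero.mpr h7F) hsqm7 hσ)
    simpa only [mul_one] using this
  · have := ell_mul_not_mem_twoIsogenySelmerGroup'_of_not_isSquare hl2 hl7 hs ht (m₀ := 1) (d₀ := -7)
      (e₀ := 1) hm (by norm_num) (by push_cast; simpa using hσ)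
    simpa only [mul_one, mul_comm (l : ℤ) (-7)] using this

/-- **`σ(ℓ) = −1`, the cell's curve `49a1^{(−ℓ)}`**: under the same hypotheses the `ℓ`-classes `ℓ, 7ℓ`
are not in `S(−ℓ) = twoIsogenySelmerGroup (−21ℓ) (112ℓ²)` (part VIII's family: so `S(−ℓ) ⊆ {1, 7, 2ℓ, 14ℓ}`
there). [cite: SilvermanAEC2009, Prop. X.4.9 and Example X.4.10] -/
theorem ell_classes_not_mem_selmer_negTwist_of_symbol_neg (hl2 : l ≠ 2) (hl7 : l ≠ 7)
    (hs : s ^ 2 = -7) (ht : t ^ 2 = 7) (hσ : ¬ IsSquare (2 * (s - 21))) :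
    (l : ℤ) ∉ twoIsogenySelmerGroup (-21 * (l : ℤ)) (112 * (l : ℤ) ^ 2) ∧
      7 * (l : ℤ) ∉ twoIsogenySelmerGroup (-21 * (l : ℤ)) (112 * (l : ℤ) ^ 2) := by
  have h7F : (7 : ZMod l) ≠ 0 := zmod_seven_ne_zero_of_prime_ne_seven hl7
  have hsq7 : IsSquare (7 : ZMod l) := ⟨t, by rw [← pow_two, ht]⟩
  obtain ⟨hsq16, hsq112⟩ := isSquare_sixteen_and_onehundredtwelve_zmod hsq7
  have hsqm1 : IsSquare (-1 : ZMod l) := isSquare_neg_one_of_sq hs ht h7F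
  have h16 : (16 : ZMod l) ≠ 0 := by
    have := zmod_two_ne_zero_of_prime_ne_two hl2; have h : (16 : ZMod l) = 2 ^ 4 := by norm_num
    rw [h]; exact pow_ne_zero _ this
  have h112 : (112 : ZMod l) ≠ 0 := by
    have h : (112 : ZMod l) = 16 * 7 := by norm_num
    rw [h]; exact mul_ne_zero h16 h7F
  have hsqm16 : IsSquare (-16 : ZMod l) := by
    obtain ⟨i, hi⟩ := hsqm1; exact ⟨4 * i, by linear_combination 16 * hi⟩
  have hsqm112 : IsSquare (-112 : ZMod l) := by
    obtain ⟨i, hi⟩ := hsqm1; obtain ⟨r, hr⟩ := hsq112; exact ⟨i * r, by linear_combination 112 * hi + i * i * hr⟩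
  have hm : ¬ (l : ℤ) ∣ -1 := fun h =>
    (Fact.out : l.Prime).ne_one (Nat.dvd_one.mp (by exact_mod_cast (dvd_neg.mp h)))
  refine ⟨?_, ?_⟩
  · have := ell_mul_not_mem_twoIsogenySelmerGroup_of_not_isSquare hl2 hl7 hs hsq7 (m₀ := -1) (d₀ := 1)
      (e₀ := 112) hm (by norm_num) (by
        push_cast
        simpa [mul_assoc] using not_isSquare_mul_of_isSquare_right (neg_ne_zero.mpr h112) hsqm112 hσ)
    simpa only [mul_one, mul_neg, neg_mul, neg_sq] using this
  · have := ell_mul_not_mem_twoIsogenySelmerGroup_of_not_isSquare hl2 hl7 hs hsq7 (m₀ := -1) (d₀ := 7)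
      (e₀ := 16) hm (by norm_num) (by
        push_cast
        simpa [mul_assoc] using not_isSquare_mul_of_isSquare_right (neg_ne_zero.mpr h16) hsqm16 hσ)
    simpa only [mul_one, mul_neg, neg_mul, neg_sq, mul_comm (l : ℤ) 7] using this

/-- **`σ(ℓ) = +1`, the cell's curve `49a1^{(−ℓ)}`, `ℓ ≡ 5 (mod 8)`** (`2 ∉ 𝔽_ℓ²`): the classes `2ℓ, 14ℓ`
are not in `S(−ℓ)` (so `S(−ℓ) ⊆ {1, 7, ℓ, 7ℓ}` there). [cite: SilvermanAEC2009, Prop. X.4.9 and Example X.4.10] -/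
theorem two_ell_classes_not_mem_selmer_negTwist_of_symbol_pos (hl2 : l ≠ 2) (hl7 : l ≠ 7)
    (hs : s ^ 2 = -7) (ht : t ^ 2 = 7) (hσ : IsSquare (2 * (s - 21))) (h2 : ¬ IsSquare (2 : ZMod l)) :
    2 * (l : ℤ) ∉ twoIsogenySelmerGroup (-21 * (l : ℤ)) (112 * (l : ℤ) ^ 2) ∧
      14 * (l : ℤ) ∉ twoIsogenySelmerGroup (-21 * (l : ℤ)) (112 * (l : ℤ) ^ 2) := by
  have h2F : (2 : ZMod l) ≠ 0 := zmod_two_ne_zero_of_prime_ne_two hl2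
  have h7F : (7 : ZMod l) ≠ 0 := zmod_seven_ne_zero_of_prime_ne_seven hl7
  have hsq7 : IsSquare (7 : ZMod l) := ⟨t, by rw [← pow_two, ht]⟩
  have hsqm1 : IsSquare (-1 : ZMod l) := isSquare_neg_one_of_sq hs ht h7F
  obtain ⟨hs21, -⟩ := sub_ne_zero_and_add_ne_zero_of_sq hs h2F h7F
  have hσ0 : (2 * (s - 21) : ZMod l) ≠ 0 := mul_ne_zero h2F hs21
  -- if `2(s−21)·c` were a square with `c ∈ {−56, −8}`, then `2` would be: `−56 = 2·(−28)`, `−28 = (2i)²·(−7)…`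
  have hsqm28 : IsSquare (-28 : ZMod l) := by
    obtain ⟨i, hi⟩ := hsqm1; obtain ⟨r, hr⟩ := hsq7; exact ⟨2 * i * r, by linear_combination 28 * hi + 4 * i * i * hr⟩
  have hsqm4 : IsSquare (-4 : ZMod l) := by
    obtain ⟨i, hi⟩ := hsqm1; exact ⟨2 * i, by linear_combination 4 * hi⟩
  have h28 : (-28 : ZMod l) ≠ 0 := by
    have h : (-28 : ZMod l) = -(2 ^ 2 * 7) := by norm_num
    rw [h]; exact neg_ne_zero.mpr (mul_ne_zero (pow_ne_zero _ h2F) h7F)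
  have h4 : (-4 : ZMod l) ≠ 0 := by
    have h : (-4 : ZMod l) = -(2 ^ 2) := by norm_num
    rw [h]; exact neg_ne_zero.mpr (pow_ne_zero _ h2F)
  have key : ∀ c : ZMod l, c ≠ 0 → IsSquare c → ¬ IsSquare (2 * (s - 21) * (2 * c)) := by
    intro c hc hsc h
    have h'' : IsSquare (2 * c) := isSquare_of_isSquare_mul_of_isSquare hσ0 hσ h
    have hc1 : IsSquare (c * 1) := by simpa using hsc
    have h2c : IsSquare ((2 : ZMod l) * 1) := isSquare_mul_of_isSquare_mul hc hc1 h''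
    exact h2 (by simpa using h2c)
  have hm : ¬ (l : ℤ) ∣ -1 := fun h =>
    (Fact.out : l.Prime).ne_one (Nat.dvd_one.mp (by exact_mod_cast (dvd_neg.mp h)))
  refine ⟨?_, ?_⟩
  · have := ell_mul_not_mem_twoIsogenySelmerGroup_of_not_isSquare hl2 hl7 hs hsq7 (m₀ := -1) (d₀ := 2)
      (e₀ := 56) hm (by norm_num) (by
        push_cast
        have e : (2 * (s - 21) * -1 * 56 : ZMod l) = 2 * (s - 21) * (2 * -28) := by ring
        rw [e]; exact key (-28) h28 hsqm28)
    simpa only [mul_one, mul_neg, neg_mul, neg_sq, mul_comm (l : ℤ) 2] using this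
  · have := ell_mul_not_mem_twoIsogenySelmerGroup_of_not_isSquare hl2 hl7 hs hsq7 (m₀ := -1) (d₀ := 14)
      (e₀ := 8) hm (by norm_num) (by
        push_cast
        have e : (2 * (s - 21) * -1 * 8 : ZMod l) = 2 * (s - 21) * (2 * -4) := by ring
        rw [e]; exact key (-4) h4 hsqm4)
    simpa only [mul_one, mul_neg, neg_mul, neg_sq, mul_comm (l : ℤ) 14] using this

/-- **`σ(ℓ) = +1`, auxiliary partner `49a1^{(a₀ℓ)}`** for `a₀` with `ℓ ∤ a₀` and `a₀ ∉ 𝔽_ℓ²` (e.g. a prime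
`a₀` with `(a₀/ℓ) = −1`): the `ℓ`-classes `ℓ, 7ℓ` are not in `S(a₀ℓ) = twoIsogenySelmerGroup (21a₀ℓ) (112(a₀ℓ)²)`
and `ℓ, −7ℓ` are not in `S'(a₀ℓ) = twoIsogenySelmerGroup (−42a₀ℓ) (−7(a₀ℓ)²)` — the COMPLEMENT of the
`σ(ℓ) = −1` statement for `49a1^{(ℓ)}`: `(a₀/ℓ) = −1` flips the symbol. [cite: SilvermanAEC2009, Prop. X.4.9 and Example X.4.10] -/
theorem ell_classes_not_mem_selmer_auxTwist_of_symbol_pos (hl2 : l ≠ 2) (hl7 : l ≠ 7)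
    (hs : s ^ 2 = -7) (ht : t ^ 2 = 7) (hσ : IsSquare (2 * (s - 21))) {a₀ : ℤ} (ha : ¬ (l : ℤ) ∣ a₀)
    (hans : ¬ IsSquare (a₀ : ZMod l)) :
    (l : ℤ) ∉ twoIsogenySelmerGroup (21 * (a₀ * (l : ℤ))) (112 * (a₀ * (l : ℤ)) ^ 2) ∧
      7 * (l : ℤ) ∉ twoIsogenySelmerGroup (21 * (a₀ * (l : ℤ))) (112 * (a₀ * (l : ℤ)) ^ 2) ∧
      (l : ℤ) ∉ twoIsogenySelmerGroup (-42 * (a₀ * (l : ℤ))) (-7 * (a₀ * (l : ℤ)) ^ 2) ∧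
      -7 * (l : ℤ) ∉ twoIsogenySelmerGroup (-42 * (a₀ * (l : ℤ))) (-7 * (a₀ * (l : ℤ)) ^ 2) := by
  have h2F : (2 : ZMod l) ≠ 0 := zmod_two_ne_zero_of_prime_ne_two hl2
  have h7F : (7 : ZMod l) ≠ 0 := zmod_seven_ne_zero_of_prime_ne_seven hl7
  have hsq7 : IsSquare (7 : ZMod l) := ⟨t, by rw [← pow_two, ht]⟩
  have hsqm7 : IsSquare (-7 : ZMod l) := ⟨s, by rw [← pow_two, hs]⟩
  obtain ⟨hsq16, hsq112⟩ := isSquare_sixteen_and_onehundredtwelve_zmod hsq7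
  obtain ⟨hs21, -⟩ := sub_ne_zero_and_add_ne_zero_of_sq hs h2F h7F
  have hσ0 : (2 * (s - 21) : ZMod l) ≠ 0 := mul_ne_zero h2F hs21
  have haF : (a₀ : ZMod l) ≠ 0 := intCast_zmod_ne_zero_of_prime_not_dvd ha
  -- `2(s−21)·a₀·(c a₀²)` a square with `c` a nonzero square ⇒ `a₀` a square
  have key : ∀ c : ZMod l, c ≠ 0 → IsSquare c → ¬ IsSquare (2 * (s - 21) * (a₀ : ZMod l) * (c * a₀ ^ 2)) := by
    intro c hc hsc h
    have h1 : IsSquare (2 * (s - 21) * ((a₀ : ZMod l) * (c * a₀ ^ 2))) := by simpa [mul_assoc] using h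
    have h2 : IsSquare ((a₀ : ZMod l) * (c * a₀ ^ 2)) := isSquare_of_isSquare_mul_of_isSquare hσ0 hσ h1
    have hca : (c * (a₀ : ZMod l) ^ 2) ≠ 0 := mul_ne_zero hc (pow_ne_zero _ haF)
    have hsca : IsSquare (c * (a₀ : ZMod l) ^ 2 * 1) := by
      obtain ⟨r, hr⟩ := hsc; exact ⟨r * a₀, by linear_combination a₀ ^ 2 * hr⟩
    have h3 : IsSquare ((a₀ : ZMod l) * 1) := isSquare_mul_of_isSquare_mul hca hsca h2
    exact hans (by simpa using h3)
  refine ⟨?_, ?_, ?_, ?_⟩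
  · have := ell_mul_not_mem_twoIsogenySelmerGroup_of_not_isSquare hl2 hl7 hs hsq7 (m₀ := a₀) (d₀ := 1)
      (e₀ := 112 * a₀ ^ 2) ha (by ring) (by
        push_cast
        exact key 112 (by
          have h : (112 : ZMod l) = 2 ^ 4 * 7 := by norm_num
          rw [h]; exact mul_ne_zero (pow_ne_zero _ h2F) h7F) hsq112)
    simpa only [mul_one, mul_comm (l : ℤ) a₀] using this
  · have := ell_mul_not_mem_twoIsogenySelmerGroup_of_not_isSquare hl2 hl7 hs hsq7 (m₀ := a₀) (d₀ := 7)
      (e₀ := 16 * a₀ ^ 2) ha (by ring) (by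
        push_cast
        exact key 16 (by
          have h : (16 : ZMod l) = 2 ^ 4 := by norm_num
          rw [h]; exact pow_ne_zero _ h2F) hsq16)
    simpa only [mul_comm (l : ℤ) a₀, mul_comm (l : ℤ) 7] using this
  · have := ell_mul_not_mem_twoIsogenySelmerGroup'_of_not_isSquare hl2 hl7 hs ht (m₀ := a₀) (d₀ := 1)
      (e₀ := -7 * a₀ ^ 2) ha (by ring) (by
        push_cast
        exact key (-7) (neg_ne_zero.mpr h7F) hsqm7)
    simpa only [mul_one, mul_comm (l : ℤ) a₀] using this
  · have := ell_mul_not_mem_twoIsogenySelmerGroup'_of_not_isSquare hl2 hl7 hs ht (m₀ := a₀) (d₀ := -7)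
      (e₀ := a₀ ^ 2) ha (by ring) (by
        push_cast
        simpa using key 1 one_ne_zero ⟨1, by norm_num⟩)
    simpa only [mul_comm (l : ℤ) a₀, mul_comm (l : ℤ) (-7)] using this

end Families

end Summit.BirchSwinnertonDyer.BirchSwinnertonDyer.Theorems.GoldfeldGoodTwists

end
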